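import Summits.HubbardSuperconductivity.HubbardSuperconductivity.Theses.DeformationLadder

/-!
# Ideator 4 (crux-ideate round 2) — typed hand-over statements for crux `LowEnergyRigidity`
(stmt-HubbardSuperconductivity-1892). No card is filed this round; these are the two NEGATIVE/calibration-side
statements of `NegativeNotesIdeator4.md` §7, typed so that a prover or the cdisprove seat can take them verbatim.
Both are about the FREE point `U = 0` (resp. a `√U` ceiling) and are expected PROVABLE by elementary per-level
Cauchy–Schwarz + Hölder + lattice-point counting (sketch in the notes). They do not bear on the truth of the crux
at `U > 0`; they quantify `lowEnergyRigidity_false_without_repulsion` uniformly over the whole energy window.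
-/

namespace Summit.HubbardSuperconductivity.HubbardSuperconductivity.Cruxes.LowEnergyRigidity.Ideator4

open Literature.MathematicalPhysics.QuantumLattice Matrix

/-- **Free window pair poverty** (hand-over statement, expected provable): at `U = 0`, in EVERY joint
sector `(N, S^z = M)` of the torus of side `L ≥ 3`, every unit vector has `d`-wave LRO density at most
`C₁ (log L)²/L² + C₂ √(free excitation energy)/L`. In particular every state within `κ` of the free
sector ground energy has LRO density `≤ C₁ log²L/L² + C₂ √κ / L → 0`: the free window contains no rigid
state at all (all-vectors, quantitative form of `re_trace_sectorEigenProj_mul_pairField_dWave_le_free`). -/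
def FreeWindowPairPoverty : Prop :=
  ∃ C₁ C₂ : ℝ, ∀ (L : ℕ) [NeZero L], 3 ≤ L → ∀ (N : ℕ) (M : ℝ)
    (φ : Fock (Orb (FermionTorus 2 L))), φ ∈ szSector N M → star φ ⬝ᵥ φ = 1 →
      (expect ((pairField dWaveFormFactor L)ᴴ * pairField dWaveFormFactor L) φ).re / (L : ℝ) ^ 4 ≤
        C₁ * Real.log L ^ 2 / (L : ℝ) ^ 2 +
          C₂ * Real.sqrt ((star φ ⬝ᵥ (hubbardTorus 2 L 1 0) *ᵥ φ).re -
              (hubbardTorus 2 L 1 0).minEnergyOn (szSector N M)) / (L : ℝ)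

/-- **Weak-coupling order ceiling for every window state** (corollary of `FreeWindowPairPoverty` and the
repulsion sandwich `H_U = H_0 + U·Σ n↑n↓`, `0 ≤ Σ n↑n↓ ≤ L²`): for `U ≥ 0` and any window `κ ≥ 0`, every
unit sector vector within `κ` of the sector ground energy of `hubbardTorus 2 L 1 U` has `d`-wave LRO
density `≤ C₁ log²L/L² + C₂ (√κ/L + √U)`. Hence any witness `(U, δ, κ, a, L₀)` of `LowEnergyRigidity`
has `a ≤ C₂ √U` (the `√U` law of the disprover's unlanded near-miss, by an all-states route). -/
def WindowOrderCeilingSqrtU : Prop :=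
  ∃ C₁ C₂ : ℝ, ∀ (L : ℕ) [NeZero L], 3 ≤ L → ∀ (U κ : ℝ), 0 ≤ U → 0 ≤ κ → ∀ (N : ℕ) (M : ℝ)
    (φ : Fock (Orb (FermionTorus 2 L))), φ ∈ szSector N M → star φ ⬝ᵥ φ = 1 →
      (star φ ⬝ᵥ (hubbardTorus 2 L 1 U) *ᵥ φ).re ≤ (hubbardTorus 2 L 1 U).minEnergyOn (szSector N M) + κ →
        (expect ((pairField dWaveFormFactor L)ᴴ * pairField dWaveFormFactor L) φ).re / (L : ℝ) ^ 4 ≤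
          C₁ * Real.log L ^ 2 / (L : ℝ) ^ 2 + C₂ * (Real.sqrt κ / (L : ℝ) + Real.sqrt U)

/-- The ceiling kills every `U`-uniform floor: if `WindowOrderCeilingSqrtU` holds then a witness of the
crux's matrix at coupling `U` with order `a` needs `a ≤ C₂ √U + o(1)`; recorded as the implication to be
proved alongside (statement only). -/
def CeilingBoundsWitnessOrder : Prop :=
  WindowOrderCeilingSqrtU →
    ∃ C : ℝ, ∀ (U δ κ a : ℝ), 0 ≤ U → 0 < κ →
      (∃ L₀ : ℕ, ∀ (L : ℕ) [NeZero L], L₀ ≤ L → Even L →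
        ∀ φ : Fock (Orb (FermionTorus 2 L)),
          φ ∈ szSector (2 * ⌊(1 - δ) * (L : ℝ) ^ 2 / 2⌋₊) 0 → star φ ⬝ᵥ φ = 1 →
            (star φ ⬝ᵥ (hubbardTorus 2 L 1 U) *ᵥ φ).re ≤
                (hubbardTorus 2 L 1 U).minEnergyOn (szSector (2 * ⌊(1 - δ) * (L : ℝ) ^ 2 / 2⌋₊) 0) + κ →
              a ≤ (expect ((pairField dWaveFormFactor L)ᴴ * pairField dWaveFormFactor L) φ).re / (L : ℝ) ^ 4) →
      a ≤ C * Real.sqrt U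

example : Prop := Summit.HubbardSuperconductivity.HubbardSuperconductivity.Theses.DeformationLadder.LowEnergyRigidity

end Summit.HubbardSuperconductivity.HubbardSuperconductivity.Cruxes.LowEnergyRigidity.Ideator4
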